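/-
  Summits/AtomisticToContinuum/Crystallization/Theorems/OverbindingBudgetAffineFarRechartCoherence.lean

  residual stmt-AtomisticToContinuum-31280 · slot Z `FarAggregatePricing 12 (1/25) (1/2000) (1/(2·10⁷))` · the rank-2 L leaf Z3k `SitewiseRechartLoss`
  (…FarRechartKernel.lean, p844159) SPLIT BY SCALE AND BY NORMAL FORM (decomp-a2c lens-4 «minimal counterexample / extremal reduction», g50).
  Imports ONLY the tree file `…OverbindingBudgetAffineFarRechartKernel`.  0 sorry · 0 axiom · no instance · no new notation.
-/
import Summits.AtomisticToContinuum.Crystallization.Theorems.OverbindingBudgetAffineFarRechartKernel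

/-! # Z3k ⟸ FF ∧ SC ∧ IC — the sitewise rechart loss split at the drift radius and put in minimal-counterexample normal form

THESIS.  Unmatched good matter around a normal far row `i` has exactly two sources: (α) ELASTIC DRIFT — in a dislocation-free but bent
`AffReg(ε₁)` crystal the best admissible structure drifts off the configuration quadratically and leaves the matching cap `nn/4` at the DRIFT
RADIUS `R_ε ≍ (C₁ε₁)^{-1/2}·nn_i`; (β) GENUINE INCOHERENCE — a second coherent structure / grain / crack that no single Barlow stacking about any axis the
core allows can represent.  (α) lives at radii `≥ R_ε` and is priced `O(ε₁)` uniformly in the window; (β) is the only mechanism available at radii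
`< R_ε` and is priced by the defect kernel.  A naive three-way split («axis classification ∧ two-defect loss ∧ crossing cost», g49 HANDOFF) founders on the
quantifier order of Z3k (`∃ C'''` BEFORE `δ`, `∃ A` AFTER): a generic packing lemma prices matter beyond radius `r` by `L(δ)·r⁻ᵖ`, so drift would route the
`ε₁`-term through `L(δ)`.  Hence TWO LAYERS, both with the glue PROVED here:

LAYER 1 · SCALE SPLIT  `SitewiseRechartLoss ⟸ FarFieldShadowBound ∧ NearFieldRechartLoss` (`sitewiseRechartLoss_of_far_near`; glue = additivity of
`smoothTail` over near ∪ far, `C''' := C₂ + C₃`, `A := A_N + A_F`).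
* FF · `FarFieldShadowBound θ θ₀` [NEW · CHART-FREE · L/M · UNDECIDED·TRUE-leaning · INSTRUMENTABLE]: for every `C₁ > 0` the tail inflow from ANY set of good sites
  beyond the drift radius (`C₁ε₁(d/nn_i)² ≥ 1`) is `≤ C₂ε₁ + A_F·defectKernel`.  Lattice-density far matter gives `T(R_ε) ≈ 0.54(C₁ε₁)^{3/2} ≤ C₂ε₁`; denser far
  matter is either reached through a wall-free quasiconformal funnel (gradual by `AffReg(ε₁)`: onset `≥ a/ε₁`, excess `O(C₁ε₁²)`; polynomial densification
  with exponent `3α` gives loss/kernel `≤ δ^{2−2/α}` because the window floor ends the funnel in walls) or sits behind walls the kernel sees with weight `d⁻²` per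
  unit solid angle against loss `δ⁻³d⁻³/3`.  Why weaker: no charts, no matching, no energy identity; a pure density-versus-defect inequality for the good class.
* NF · `NearFieldRechartLoss θ θ₀` [coarse alternative, = Z3k restricted to the near field; NF chooses `C₁`].

LAYER 2 · NORMAL-FORM SPLIT of NF (the lens)  `NearFieldRechartLoss ⟸ ShortRangeCoherence ∧ IncoherenceCost` (`nearFieldRechartLoss_of_coherence_cost`,
with the packing tail lemma `neg_smoothTail_le_of_radius` PROVED in §1).  One new predicate, a property of the RECHART CLASS of `c` (gauge-invariant:
`coarseCoherent_iff_of_recharts`): `CoarseCoherent θ ε₁ δ y i c s` := some rechart of `c` represents every good site within `s·nn_i` of `y i` injectively within the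
cap `nn_i/4` (fine ⇒ coarse: `coarseCoherent_of_matched`).  «Every near-field counterexample to Z3k reduces to one in normal form»: a row whose class is coherent
and finely matched out to `r` but COARSELY INCOHERENT at `2r < 2R_ε` — and «no counterexample in normal form» = incoherence at short range costs a line.
* SC · `ShortRangeCoherence θ θ₀` [NEW · M · TRUE-type · ATTACKABLE now]: `∃ C₀ ∀ C₁ ≥ C₀ ∃ D ε_S …` a rechart `c'`, a fine matching `(M, π)` (`Matched D ε₁`) covering
  ALL good sites within `r·nn_i`, `r ≥ 1`, and (`C₁ε₁r² ≥ 1` ∨ `¬CoarseCoherent(2r)`).  Proof plan: `r* := sup{s : CoarseCoherent s} ≥ 2` (the exact chart represents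
  its own 9-ball once `Cε₁ ≤ 1/4`, injectively by the separation of sites near a good site); if `r* ≥ 2R_ε` take `r := R_ε ≤ r_cap(D)` (needs `C₁ ≥ 8D`, `D ≥ c·max(C,1)`
  — whence `C₀`), else `r ∈ (r*/2, r*)`; coarse-represented good matter at `d ≤ R_ε` is finely matched because the deviation from the chart's affine image is
  SECOND order along chains of `AffReg(ε₁)` sites (`≤ cε₁d²`, the linear part is absorbed by `c.B`; behind an isolated defect cluster at distance `≥ d_h` the kink
  is `≤ 0.04·d/d_h³ ≪ Dε₁d²`).  Why weaker: no inflow, no kernel; a local-to-global coherence statement at radii where drift cannot bite.  Might fail: coarse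
  coherence attained only by recharts whose fine matching fails near `r` for an `ε₁`-free `D`.
* IC · `IncoherenceCost θ θ₀` [NEW · M/L · UNDECIDED·TRUE-leaning · INSTRUMENTABLE (= census «Z3k-ROW», constant κ)]: `∃ C₁ κ …` for every `r ≥ 1` with `C₁ε₁r² ≤ 1`,
  `¬CoarseCoherent(2r) ⇒ κ ≤ r³·defectKernel`.  Content (memo COUNTEREX-g49-Z3b §9b): at radii below the drift radius incoherence of an exact chart's class needs a
  second structure; two plane families within `2r` of the row cross on a line within `≈ 7.2r` carrying `c ≈ 640–700` non-good sites per `nn` (halo 12nn) ⇒ kernel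
  `≥ c·π/(2(7.2r)³) ≈ 3/r³` (`κ ≤ 3`); a finite foreign fault ends on a partial (non-good tube `≥ 750/nn`, radius `≥ 0.3ε₁^{-1/2}`); a grain or a closed crack with
  offset is walled (`r⁻²`); removing the crossing line from the sample leaves free surface `≥ 115/nn` along it; drift over `2r ≤ 2R_ε` is `≤ 4c/C₁·nn < nn/8` and the
  `Cε₁`-jitter of the class (`a₀`, strain, core points pinned by `IsChart`) moves structure points by `≤ 12C(ε₁/C₁)^{1/2}nn` — both invisible at tolerance `nn/4`
  (foreign-family sites sit `≥ 0.56nn` from every structure point even at 12 % strain).  Why weaker: no matching to produce, no inflow; pure incidence geometry of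
  close-packed plane families + halo counting.  Might fail: a short-range incoherence whose defect locus is a bounded cluster (kernel `r⁻⁴`) — excluded on paper
  because a cluster neither terminates a fault nor shifts a half-space, but this is exactly the statement to test (KILL: κ_measured → 0 along the census rows).

WHY NOVEL (vs v5–v8 and Z3k): the cut is no longer by ROW CLASS (sheltered/unsheltered, v7) or by GAUGE (Continues → Recharts, v8) but by SCALE relative to the
drift radius and by COARSE vs FINE representation; `CoarseCoherent` is the first typed notion of «foreign coherent structure at distance m» that is invariant under
everything `IsChart` cannot see, and FF is the first chart-free leaf of slot Z since Z4″.
HIDDEN-GAUGE AUDIT: every ∀-quantified chart datum enters SC/IC only through `Recharts θ c ·` and `CoarseCoherent … c ·`, both constant on rechart classes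
(`recharts_iff_of_recharts`, `coarseCoherent_iff_of_recharts`); FF and TP mention no chart.  Constants: `C₀, C₁, D, C₂, C₃, ε` before `ε₁`; `κ, A, L` after `δ`
(`A` may also depend on `ε₁`, as Z3k permits: the proved packing lemma is the cheap `r⁻²` form and the lost factor `r ≤ 1/(C₁ε₁)` is absorbed there).
PROBES (g50/bc/ProbeCoherence.lean): must-fail `FF, NF, SC, IC, FF∧SC, FF∧IC, SC∧IC ⇒ Z3k`, each piece outright, each ⇒ slot Z; must-pass the three glue theorems
and the record corollaries by name; `#print axioms` standard.
-/

namespace Summit.AtomisticToContinuum.Crystallization.Theorems.OverbindingBudgetAffineFarSmoothSplit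

open scoped BigOperators Classical
open Literature.MathematicalPhysics.StatisticalMechanics
open Literature.Geometry.DiscreteGeometry (nearestDist nearestDist_nonneg nearestDist_le_dist)
open Summit.AtomisticToContinuum.Crystallization.Theorems.OverbindingBudgetBalancedCensusStatements
open Summit.AtomisticToContinuum.Crystallization.Theorems.OverbindingBudgetAffineLadder
open Summit.AtomisticToContinuum.Crystallization.Theorems.OverbindingBudgetAffineLocalisation

variable {N : ℕ}

local notation "E3" => EuclideanSpace ℝ (Fin 3)

/-! ## §1  The packing tail lemma (PROVED) -/

/-- One smooth-tail term is at most the bare attractive tail: `−tailW·V(d) ≤ d⁻⁶/6` (`0 ≤ tailW ≤ 1`, `V ≥ −d⁻⁶/6`). [this file] -/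
theorem neg_tailW_mul_lennardJones_le (nn : ℝ) {d : ℝ} (hd : 0 < d) :
    -(tailW nn d * lennardJones d) ≤ 1 / 6 * (d⁻¹) ^ 6 := by
  have hV : -lennardJones d ≤ 1 / 6 * (d⁻¹) ^ 6 := by
    have h := neg_le_lennardJones_of_le hd le_rfl
    linarith
  have hb : (0 : ℝ) ≤ 1 / 6 * (d⁻¹) ^ 6 := by positivity
  have h1 : tailW nn d * (-lennardJones d) ≤ tailW nn d * (1 / 6 * (d⁻¹) ^ 6) :=
    mul_le_mul_of_nonneg_left hV (tailW_nonneg nn d)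
  have h2 : tailW nn d * (1 / 6 * (d⁻¹) ^ 6) ≤ 1 / 6 * (d⁻¹) ^ 6 := mul_le_of_le_one_left hb (tailW_le_one nn d)
  linarith

/-- **TP · PACKING TAIL BEYOND A RADIUS (PROVED)**: for a good row `i`, a sub-class `S ⊆ G` all of whose sites lie at distance `≥ r·nn_i` (`r ≥ 1`) has
`−smoothTail S y i ≤ 2¹⁴/(12δ⁹)/r²` — termwise `d⁻⁶ ≤ (rδ)⁻²·δ⁻⁴·(nn_k/d)⁴` and the kernel column bound `sum_kernelTerm_col_le`. [this file] -/
theorem neg_smoothTail_le_of_radius {ρ₁ ε₁ θ δ : ℝ} (hδ : 0 < δ) (hδ2 : δ ≤ 2) {y : Fin N → E3} (hy : Function.Injective y)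
    {i : Fin N} (hi : i ∈ goodSet ρ₁ ε₁ θ δ y) {S : Finset (Fin N)} (hS : S ⊆ goodSet ρ₁ ε₁ θ δ y) {r : ℝ} (hr : 1 ≤ r)
    (hfar : ∀ k ∈ S, r * nearestDist y i ≤ dist (y i) (y k)) :
    -smoothTail S y i ≤ 2 ^ 14 / (12 * δ ^ 9) / r ^ 2 := by
  have hnn : δ ≤ nearestDist y i := (inWindow_of_mem_goodSet hi).1
  have hterm : ∀ k ∈ S, -(tailW (nearestDist y i) (dist (y i) (y k)) * lennardJones (dist (y i) (y k)))
      ≤ 1 / (6 * δ ^ 6 * r ^ 2) * (nearestDist y k / dist (y k) (y i)) ^ 4 := by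
    intro k hk
    have hrδ : r * δ ≤ dist (y i) (y k) := le_trans (mul_le_mul_of_nonneg_left hnn (by linarith)) (hfar k hk)
    have hd : 0 < dist (y i) (y k) := lt_of_lt_of_le (by positivity) hrδ
    have hnk : δ ≤ nearestDist y k := (inWindow_of_mem_goodSet (hS hk)).1
    refine (neg_tailW_mul_lennardJones_le _ hd).trans ?_
    rw [dist_comm (y k) (y i)]
    have h4 : (δ / dist (y i) (y k)) ^ 4 ≤ (nearestDist y k / dist (y i) (y k)) ^ 4 :=
      pow_le_pow_left₀ (by positivity) (div_le_div_of_nonneg_right hnk hd.le) 4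
    have h2 : ((dist (y i) (y k))⁻¹) ^ 2 ≤ ((r * δ)⁻¹) ^ 2 :=
      pow_le_pow_left₀ (inv_nonneg.mpr hd.le) (inv_anti₀ (by positivity) hrδ) 2
    have hkey : ((dist (y i) (y k))⁻¹) ^ 6 ≤ (nearestDist y k / dist (y i) (y k)) ^ 4 / δ ^ 4 * ((r * δ)⁻¹) ^ 2 := by
      have hsplit : ((dist (y i) (y k))⁻¹) ^ 6 = ((δ / dist (y i) (y k)) ^ 4 / δ ^ 4) * ((dist (y i) (y k))⁻¹) ^ 2 := by
        field_simp
      rw [hsplit]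
      exact mul_le_mul (div_le_div_of_nonneg_right h4 (by positivity)) h2 (by positivity) (by positivity)
    have hδr : (nearestDist y k / dist (y i) (y k)) ^ 4 / δ ^ 4 * ((r * δ)⁻¹) ^ 2
        = 1 / (δ ^ 6 * r ^ 2) * (nearestDist y k / dist (y i) (y k)) ^ 4 := by
      field_simp
    rw [hδr] at hkey
    have h6 : 1 / (6 * δ ^ 6 * r ^ 2) * (nearestDist y k / dist (y i) (y k)) ^ 4
        = 1 / 6 * (1 / (δ ^ 6 * r ^ 2) * (nearestDist y k / dist (y i) (y k)) ^ 4) := by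
      field_simp
    rw [h6]
    exact mul_le_mul_of_nonneg_left hkey (by norm_num)
  have hS4 : ∑ k ∈ S, (nearestDist y k / dist (y k) (y i)) ^ 4 ≤ 2 ^ 14 / δ ^ 3 :=
    le_trans (Finset.sum_le_sum_of_subset_of_nonneg hS fun k _ _ => by positivity) (sum_kernelTerm_col_le hδ hδ2 hy i)
  have hsum : -smoothTail S y i
      = 1 / 2 * ∑ k ∈ S, -(tailW (nearestDist y i) (dist (y i) (y k)) * lennardJones (dist (y i) (y k))) := by
    unfold smoothTail
    rw [Finset.sum_neg_distrib]
    ring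
  rw [hsum]
  calc 1 / 2 * ∑ k ∈ S, -(tailW (nearestDist y i) (dist (y i) (y k)) * lennardJones (dist (y i) (y k)))
      ≤ 1 / 2 * ∑ k ∈ S, 1 / (6 * δ ^ 6 * r ^ 2) * (nearestDist y k / dist (y k) (y i)) ^ 4 :=
        mul_le_mul_of_nonneg_left (Finset.sum_le_sum hterm) (by norm_num)
    _ = 1 / 2 * (1 / (6 * δ ^ 6 * r ^ 2)) * ∑ k ∈ S, (nearestDist y k / dist (y k) (y i)) ^ 4 := by
        rw [← Finset.mul_sum]; ring
    _ ≤ 1 / 2 * (1 / (6 * δ ^ 6 * r ^ 2)) * (2 ^ 14 / δ ^ 3) := mul_le_mul_of_nonneg_left hS4 (by positivity)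
    _ = 2 ^ 14 / (12 * δ ^ 9) / r ^ 2 := by
        field_simp
        ring

/-! ## §2  Coarse coherence of a rechart class (the normal-form predicate) -/

/-- `CoarseCoherent θ ε₁ δ y i c s`: SOME rechart `c'` of `c` (`Recharts θ c c'`: same scale, same physical core points, free axis among those the core allows,
free Hägg continuation) REPRESENTS every good site within `s · nearestDist y i` of `y i` — injectively, by structure points, within the cap `nearestDist y i / 4`
(coarse: no drift precision).  A property of the rechart CLASS of `c` (`coarseCoherent_iff_of_recharts`); antitone in `s`; implied by a covering fine matching. -/
def CoarseCoherent (θ ε₁ δ : ℝ) (y : Fin N → E3) (i : Fin N) (c : Chart) (s : ℝ) : Prop :=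
  ∃ (c' : Chart) (π : Fin N → E3), Recharts θ c c' ∧
    Set.InjOn π {k : Fin N | k ∈ goodSet 12 ε₁ θ δ y ∧ dist (y k) (y i) ≤ s * nearestDist y i} ∧
    ∀ k ∈ goodSet 12 ε₁ θ δ y, dist (y k) (y i) ≤ s * nearestDist y i →
      π k ∈ barlowStacking 1 (Real.sqrt (2 / 3)) c'.s ∧ dist (y k) (y i + c'.a₀ • c'.B (π k)) ≤ nearestDist y i / 4

/-- **Gauge invariance**: coarse coherence is constant on rechart classes. [this file] -/
theorem coarseCoherent_iff_of_recharts {θ ε₁ δ : ℝ} {y : Fin N → E3} {i : Fin N} {c d : Chart} (h : Recharts θ c d) (s : ℝ) :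
    CoarseCoherent θ ε₁ δ y i c s ↔ CoarseCoherent θ ε₁ δ y i d s := by
  constructor
  · rintro ⟨c', π, hc', hinj, hrep⟩
    exact ⟨c', π, (recharts_iff_of_recharts h).mp hc', hinj, hrep⟩
  · rintro ⟨c', π, hc', hinj, hrep⟩
    exact ⟨c', π, (recharts_iff_of_recharts h).mpr hc', hinj, hrep⟩

/-- Coarse coherence is antitone in the radius. [this file] -/
theorem coarseCoherent_mono {θ ε₁ δ : ℝ} {y : Fin N → E3} {i : Fin N} {c : Chart} {s s' : ℝ} (hss : s' ≤ s)
    (h : CoarseCoherent θ ε₁ δ y i c s) : CoarseCoherent θ ε₁ δ y i c s' := by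
  obtain ⟨c', π, hc', hinj, hrep⟩ := h
  have hnn : 0 ≤ nearestDist y i := nearestDist_nonneg y i
  have hsub : {k : Fin N | k ∈ goodSet 12 ε₁ θ δ y ∧ dist (y k) (y i) ≤ s' * nearestDist y i}
      ⊆ {k : Fin N | k ∈ goodSet 12 ε₁ θ δ y ∧ dist (y k) (y i) ≤ s * nearestDist y i} :=
    fun k hk => ⟨hk.1, hk.2.trans (mul_le_mul_of_nonneg_right hss hnn)⟩
  exact ⟨c', π, hc', hinj.mono hsub, fun k hk hd => hrep k hk (hd.trans (mul_le_mul_of_nonneg_right hss hnn))⟩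

/-- **Fine ⇒ coarse**: a fine matching by a rechart that covers the good `s`-ball witnesses coarse coherence at `s` (`matchTol ≤ nn/4`). [this file] -/
theorem coarseCoherent_of_matched {θ D ε₁ δ : ℝ} {y : Fin N → E3} {i : Fin N} {c c' : Chart} {M : Finset (Fin N)} {π : Fin N → E3} {s : ℝ}
    (hc : Recharts θ c c') (hM : Matched D ε₁ y i c' M π)
    (hcov : ∀ k ∈ goodSet 12 ε₁ θ δ y, dist (y k) (y i) ≤ s * nearestDist y i → k ∈ M) :
    CoarseCoherent θ ε₁ δ y i c s :=
  ⟨c', π, hc, hM.1.mono fun k hk => Finset.mem_coe.mpr (hcov k hk.1 hk.2), fun k hk hd =>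
    ⟨(hM.2 k (hcov k hk hd)).1, (hM.2 k (hcov k hk hd)).2.trans (matchTol_le_quarter _ _ _ _)⟩⟩

/-! ## §3  The pieces -/

/-- **FF · `FarFieldShadowBound θ θ₀`** (NEW · CHART-FREE · L/M · UNDECIDED·TRUE-leaning · INSTRUMENTABLE): R_aff ⇒ for every drift constant `C₁ > 0` there are
`C₂ ≥ 0`, `ε_F > 0` such that for `ε₁ ≤ ε_F`, every window `δ ∈ (0,2]`, some `A_F ≥ 0`, every injective configuration, every NORMAL far row `i ∈ Far ∖ sb` and EVERY
set `S` of good sites beyond the drift radius (`1 ≤ C₁ε₁(|y i − y k|/nn_i)²` on `S`): `−smoothTail S y i ≤ C₂·ε₁ + A_F·defectKernel 12 ε₁ θ δ y i`.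
Might fail: wall-free densification towards a normal row faster than the window-ended funnel analysis allows (sitewise loss/kernel unbounded at fixed `δ`). -/
def FarFieldShadowBound (θ θ₀ : ℝ) : Prop :=
  AffineChartStraightening → ∀ C₁ : ℝ, 0 < C₁ → ∃ C₂ εF : ℝ, 0 ≤ C₂ ∧ 0 < εF ∧
    ∀ ε₁ : ℝ, 0 < ε₁ → ε₁ ≤ εF → ∀ δ : ℝ, 0 < δ → δ ≤ 2 → ∃ A : ℝ, 0 ≤ A ∧
      ∀ (N : ℕ) (y : Fin N → E3), Function.Injective y →
        ∀ i ∈ farSet θ₀ 12 ε₁ θ δ y \ goodScaleBadSet 12 ε₁ θ δ y,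
          ∀ S : Finset (Fin N), S ⊆ goodSet 12 ε₁ θ δ y →
            (∀ k ∈ S, 1 ≤ C₁ * ε₁ * (dist (y i) (y k) / nearestDist y i) ^ 2) →
              -smoothTail S y i ≤ C₂ * ε₁ + A * defectKernel 12 ε₁ θ δ y i

/-- **NF · `NearFieldRechartLoss θ θ₀`** (coarse alternative = Z3k restricted to the near field; split further in §4): R_aff ⇒ `∀ C ≥ 0 ∃ C₁ > 0, D, C₃ ≥ 0, ε_N > 0`,
`∀ ε₁ ≤ ε_N ∀ δ ∃ A_N ≥ 0`: every normal far row with an admissible `Cε₁`-exact chart `c` has a rechart `c'`, a fine matching `(M, π)` and NEAR-FIELD unmatched inflow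
`−smoothTail ((G ∖ M) ∩ {C₁ε₁(d/nn_i)² < 1}) y i ≤ C₃·ε₁ + A_N·defectKernel`. -/
def NearFieldRechartLoss (θ θ₀ : ℝ) : Prop :=
  AffineChartStraightening → ∀ C : ℝ, 0 ≤ C → ∃ C₁ D C₃ εN : ℝ, 0 < C₁ ∧ 0 ≤ D ∧ 0 ≤ C₃ ∧ 0 < εN ∧
    ∀ ε₁ : ℝ, 0 < ε₁ → ε₁ ≤ εN → ∀ δ : ℝ, 0 < δ → δ ≤ 2 → ∃ A : ℝ, 0 ≤ A ∧
      ∀ (N : ℕ) (y : Fin N → E3), Function.Injective y →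
        ∀ i ∈ farSet θ₀ 12 ε₁ θ δ y \ goodScaleBadSet 12 ε₁ θ δ y, ∀ c : Chart, IsChart C ε₁ y i c → ChartAdmissible θ c →
          ∃ (c' : Chart) (M : Finset (Fin N)) (π : Fin N → E3),
            Recharts θ c c' ∧ M ⊆ goodSet 12 ε₁ θ δ y ∧ Matched D ε₁ y i c' M π ∧
            -smoothTail ((goodSet 12 ε₁ θ δ y \ M).filter fun k =>
                C₁ * ε₁ * (dist (y i) (y k) / nearestDist y i) ^ 2 < 1) y i
              ≤ C₃ * ε₁ + A * defectKernel 12 ε₁ θ δ y i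

/-- **SC · `ShortRangeCoherence θ θ₀`** (NEW · M · TRUE-type · ATTACKABLE now — the reduction to normal form): R_aff ⇒ `∀ C ≥ 0 ∃ C₀ > 0 ∀ C₁ ≥ C₀ ∃ D ≥ 0, ε_S > 0`,
`∀ ε₁ ≤ ε_S ∀ δ`: every normal far row with an admissible `Cε₁`-exact chart `c` has a rechart `c'`, a fine matching `(M, π)` and a radius `r ≥ 1` such that EVERY good
site within `r·nn_i` is matched, and either the matched ball reaches the drift radius (`1 ≤ C₁ε₁r²`) or the class of `c` is coarsely INCOHERENT at `2r`.
Might fail: coarse coherence attained only by recharts whose fine matching (tolerance `Dε₁nn(1+d²)`, `D` free of `ε₁`) fails behind defect clusters near `r`. -/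
def ShortRangeCoherence (θ θ₀ : ℝ) : Prop :=
  AffineChartStraightening → ∀ C : ℝ, 0 ≤ C → ∃ C₀ : ℝ, 0 < C₀ ∧ ∀ C₁ : ℝ, C₀ ≤ C₁ → ∃ D εS : ℝ, 0 ≤ D ∧ 0 < εS ∧
    ∀ ε₁ : ℝ, 0 < ε₁ → ε₁ ≤ εS → ∀ δ : ℝ, 0 < δ → δ ≤ 2 →
      ∀ (N : ℕ) (y : Fin N → E3), Function.Injective y →
        ∀ i ∈ farSet θ₀ 12 ε₁ θ δ y \ goodScaleBadSet 12 ε₁ θ δ y, ∀ c : Chart, IsChart C ε₁ y i c → ChartAdmissible θ c →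
          ∃ (c' : Chart) (M : Finset (Fin N)) (π : Fin N → E3) (r : ℝ),
            Recharts θ c c' ∧ M ⊆ goodSet 12 ε₁ θ δ y ∧ Matched D ε₁ y i c' M π ∧ 1 ≤ r ∧
            (∀ k ∈ goodSet 12 ε₁ θ δ y, dist (y k) (y i) ≤ r * nearestDist y i → k ∈ M) ∧
            (1 ≤ C₁ * ε₁ * r ^ 2 ∨ ¬ CoarseCoherent θ ε₁ δ y i c (2 * r))

/-- **IC · `IncoherenceCost θ θ₀`** (NEW · M/L · UNDECIDED·TRUE-leaning · INSTRUMENTABLE — «no counterexample in normal form»): R_aff ⇒ `∀ C ≥ 0 ∃ C₁ > 0, ε_I > 0`,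
`∀ ε₁ ≤ ε_I ∀ δ ∃ κ > 0`: for every normal far row with an admissible `Cε₁`-exact chart `c` and every radius `1 ≤ r` below the drift radius (`C₁ε₁r² ≤ 1`), coarse
INCOHERENCE of the class of `c` at `2r` forces `κ ≤ r³ · defectKernel 12 ε₁ θ δ y i` (a codimension-≤2 set of non-good sites within `O(r)`).
Might fail: a short-range incoherence whose whole defect locus is a bounded cluster (kernel weight `r⁻⁴`). -/
def IncoherenceCost (θ θ₀ : ℝ) : Prop :=
  AffineChartStraightening → ∀ C : ℝ, 0 ≤ C → ∃ C₁ εI : ℝ, 0 < C₁ ∧ 0 < εI ∧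
    ∀ ε₁ : ℝ, 0 < ε₁ → ε₁ ≤ εI → ∀ δ : ℝ, 0 < δ → δ ≤ 2 → ∃ κ : ℝ, 0 < κ ∧
      ∀ (N : ℕ) (y : Fin N → E3), Function.Injective y →
        ∀ i ∈ farSet θ₀ 12 ε₁ θ δ y \ goodScaleBadSet 12 ε₁ θ δ y, ∀ c : Chart, IsChart C ε₁ y i c → ChartAdmissible θ c →
          ∀ r : ℝ, 1 ≤ r → C₁ * ε₁ * r ^ 2 ≤ 1 → ¬ CoarseCoherent θ ε₁ δ y i c (2 * r) →
            κ ≤ r ^ 3 * defectKernel 12 ε₁ θ δ y i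

/-! ## §4  The glue (PROVED) -/

/-- ★ **LAYER 2: `ShortRangeCoherence ∧ IncoherenceCost ⇒ NearFieldRechartLoss`** — take `C₁ := max C₀ C₁ᴵ`, the rechart and the matched ball of SC; if the ball
reaches the drift radius the near-field unmatched class is EMPTY; otherwise IC gives `κ ≤ r³·K` and the packing tail lemma prices the unmatched class beyond `r` by
`L/r² ≤ (L/(κC₁ε₁))·K` (`r ≤ r² ≤ 1/(C₁ε₁)`). [this file] -/
theorem nearFieldRechartLoss_of_coherence_cost {θ θ₀ : ℝ} (hS : ShortRangeCoherence θ θ₀) (hI : IncoherenceCost θ θ₀) :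
    NearFieldRechartLoss θ θ₀ := by
  intro hR C hC
  obtain ⟨C₁, εI, hC₁, hεI, hIC⟩ := hI hR C hC
  obtain ⟨C₀, hC₀, hSC⟩ := hS hR C hC
  obtain ⟨D, εS, hD, hεS, hSC'⟩ := hSC (max C₀ C₁) (le_max_left _ _)
  have hC₁' : 0 < max C₀ C₁ := lt_of_lt_of_le hC₁ (le_max_right _ _)
  refine ⟨max C₀ C₁, D, 0, min εI εS, hC₁', hD, le_rfl, lt_min hεI hεS, fun ε₁ hε₁ hε₁le δ hδ hδ2 => ?_⟩
  obtain ⟨κ, hκ, hIC'⟩ := hIC ε₁ hε₁ (hε₁le.trans (min_le_left _ _)) δ hδ hδ2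
  refine ⟨2 ^ 14 / (12 * δ ^ 9) / (κ * (max C₀ C₁ * ε₁)), by positivity, fun N y hy i hi c hc hca => ?_⟩
  obtain ⟨c', M, π, r, hcc', hMG, hM, hr, hcov, hdisj⟩ :=
    hSC' ε₁ hε₁ (hε₁le.trans (min_le_right _ _)) δ hδ hδ2 N y hy i hi c hc hca
  refine ⟨c', M, π, hcc', hMG, hM, ?_⟩
  have hiG : i ∈ goodSet 12 ε₁ θ δ y := farSet_subset_goodSet θ₀ 12 ε₁ θ δ y (Finset.mem_sdiff.mp hi).1
  have hnn : 0 < nearestDist y i := lt_of_lt_of_le hδ (inWindow_of_mem_goodSet hiG).1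
  have hK : 0 ≤ defectKernel 12 ε₁ θ δ y i := defectKernel_nonneg 12 ε₁ θ δ y i
  have hCε : 0 < max C₀ C₁ * ε₁ := mul_pos hC₁' hε₁
  rw [zero_mul, zero_add]
  by_cases h1 : 1 ≤ max C₀ C₁ * ε₁ * r ^ 2
  · -- the matched ball contains the whole near field: the unmatched near-field class is empty
    have hSe : ((goodSet 12 ε₁ θ δ y \ M).filter fun k =>
        max C₀ C₁ * ε₁ * (dist (y i) (y k) / nearestDist y i) ^ 2 < 1) = ∅ := by
      refine Finset.eq_empty_of_forall_notMem fun k hk => ?_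
      rw [Finset.mem_filter, Finset.mem_sdiff] at hk
      obtain ⟨⟨hkG, hkM⟩, hlt⟩ := hk
      have hsq : (dist (y i) (y k) / nearestDist y i) ^ 2 < r ^ 2 := by
        by_contra hcon
        have hge := mul_le_mul_of_nonneg_left (not_lt.mp hcon) hCε.le
        linarith
      have hlt' : dist (y i) (y k) / nearestDist y i < r := (abs_lt_of_sq_lt_sq' hsq (by linarith)).2
      exact hkM (hcov k hkG (by rw [dist_comm]; exact ((div_lt_iff₀ hnn).mp hlt').le))
    rw [hSe]
    simp only [smoothTail, Finset.sum_empty, mul_zero, neg_zero]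
    positivity
  · have h1' : max C₀ C₁ * ε₁ * r ^ 2 < 1 := not_le.mp h1
    have hinc : ¬ CoarseCoherent θ ε₁ δ y i c (2 * r) := hdisj.resolve_left h1
    have hC₁r : C₁ * ε₁ * r ^ 2 ≤ 1 :=
      le_trans (mul_le_mul_of_nonneg_right (mul_le_mul_of_nonneg_right (le_max_right C₀ C₁) hε₁.le) (by positivity)) h1'.le
    have hκK : κ ≤ r ^ 3 * defectKernel 12 ε₁ θ δ y i := hIC' N y hy i hi c hc hca r hr hC₁r hinc
    have hSG : ((goodSet 12 ε₁ θ δ y \ M).filter fun k =>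
        max C₀ C₁ * ε₁ * (dist (y i) (y k) / nearestDist y i) ^ 2 < 1) ⊆ goodSet 12 ε₁ θ δ y :=
      (Finset.filter_subset _ _).trans Finset.sdiff_subset
    have hSfar : ∀ k ∈ ((goodSet 12 ε₁ θ δ y \ M).filter fun k =>
        max C₀ C₁ * ε₁ * (dist (y i) (y k) / nearestDist y i) ^ 2 < 1), r * nearestDist y i ≤ dist (y i) (y k) := by
      intro k hk
      rw [Finset.mem_filter, Finset.mem_sdiff] at hk
      obtain ⟨⟨hkG, hkM⟩, -⟩ := hk
      by_contra hcon
      exact hkM (hcov k hkG (by rw [dist_comm]; exact (not_le.mp hcon).le))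
    have hTP := neg_smoothTail_le_of_radius hδ hδ2 hy hiG hSG hr hSfar
    have hL : (0 : ℝ) ≤ 2 ^ 14 / (12 * δ ^ 9) := by positivity
    have hr1 : max C₀ C₁ * ε₁ * r ≤ 1 := by
      have hrr : r ≤ r ^ 2 := by nlinarith
      exact le_trans (mul_le_mul_of_nonneg_left hrr hCε.le) h1'.le
    have hone : 1 ≤ r ^ 3 * defectKernel 12 ε₁ θ δ y i / κ := (one_le_div hκ).mpr hκK
    have hrpos : 0 < r := by linarith
    calc -smoothTail ((goodSet 12 ε₁ θ δ y \ M).filter fun k =>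
            max C₀ C₁ * ε₁ * (dist (y i) (y k) / nearestDist y i) ^ 2 < 1) y i
        ≤ 2 ^ 14 / (12 * δ ^ 9) / r ^ 2 := hTP
      _ ≤ 2 ^ 14 / (12 * δ ^ 9) / r ^ 2 * (r ^ 3 * defectKernel 12 ε₁ θ δ y i / κ) :=
          le_mul_of_one_le_right (by positivity) hone
      _ = 2 ^ 14 / (12 * δ ^ 9) * defectKernel 12 ε₁ θ δ y i / κ * r := by
          field_simp
      _ ≤ 2 ^ 14 / (12 * δ ^ 9) * defectKernel 12 ε₁ θ δ y i / κ * (1 / (max C₀ C₁ * ε₁)) :=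
          mul_le_mul_of_nonneg_left (by rw [le_div_iff₀ hCε]; linarith) (by positivity)
      _ = 2 ^ 14 / (12 * δ ^ 9) / (κ * (max C₀ C₁ * ε₁)) * defectKernel 12 ε₁ θ δ y i := by
          field_simp

/-- ★ **LAYER 1: `FarFieldShadowBound ∧ NearFieldRechartLoss ⇒ SitewiseRechartLoss`** — `C₁` from NF, `C''' := C₂ + C₃`, `A := A_N + A_F`; the unmatched class
splits into its near-field part (NF) and its far-field part (FF with `S := (G ∖ M) ∖ near`), `smoothTail` is additive (`smoothTail_eq_add_sdiff`). [this file] -/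
theorem sitewiseRechartLoss_of_far_near {θ θ₀ : ℝ} (hF : FarFieldShadowBound θ θ₀) (hN : NearFieldRechartLoss θ θ₀) :
    SitewiseRechartLoss θ θ₀ := by
  intro hR C hC
  obtain ⟨C₁, D, C₃, εN, hC₁, hD, hC₃, hεN, hNF⟩ := hN hR C hC
  obtain ⟨C₂, εF, hC₂, hεF, hFF⟩ := hF hR C₁ hC₁
  refine ⟨D, C₂ + C₃, min εN εF, hD, by positivity, lt_min hεN hεF, fun ε₁ hε₁ hε₁le δ hδ hδ2 => ?_⟩
  obtain ⟨AN, hAN, hN'⟩ := hNF ε₁ hε₁ (hε₁le.trans (min_le_left _ _)) δ hδ hδ2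
  obtain ⟨AF, hAF, hF'⟩ := hFF ε₁ hε₁ (hε₁le.trans (min_le_right _ _)) δ hδ hδ2
  refine ⟨AN + AF, by positivity, fun N y hy i hi c hc hca => ?_⟩
  obtain ⟨c', M, π, hcc', hMG, hM, hnear⟩ := hN' N y hy i hi c hc hca
  refine ⟨c', M, π, hcc', hMG, hM, ?_⟩
  have hsub : ((goodSet 12 ε₁ θ δ y \ M).filter fun k =>
      C₁ * ε₁ * (dist (y i) (y k) / nearestDist y i) ^ 2 < 1) ⊆ goodSet 12 ε₁ θ δ y \ M := Finset.filter_subset _ _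
  have hfar := hF' N y hy i hi ((goodSet 12 ε₁ θ δ y \ M) \ ((goodSet 12 ε₁ θ δ y \ M).filter fun k =>
      C₁ * ε₁ * (dist (y i) (y k) / nearestDist y i) ^ 2 < 1)) (Finset.sdiff_subset.trans Finset.sdiff_subset)
    (fun k hk => by
      rw [Finset.mem_sdiff, Finset.mem_filter] at hk
      by_contra hcon
      exact hk.2 ⟨hk.1, not_le.mp hcon⟩)
  have hK : 0 ≤ defectKernel 12 ε₁ θ δ y i := defectKernel_nonneg 12 ε₁ θ δ y i
  rw [smoothTail_eq_add_sdiff hsub y i, neg_add]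
  linarith

/-- ★ **THE NODE: `FarFieldShadowBound ∧ ShortRangeCoherence ∧ IncoherenceCost ⇒ SitewiseRechartLoss`** (Z3k by name). [this file] -/
theorem sitewiseRechartLoss_of_far_coherence_cost {θ θ₀ : ℝ} (hF : FarFieldShadowBound θ θ₀) (hS : ShortRangeCoherence θ θ₀)
    (hI : IncoherenceCost θ θ₀) : SitewiseRechartLoss θ θ₀ :=
  sitewiseRechartLoss_of_far_near hF (nearFieldRechartLoss_of_coherence_cost hS hI)

/-- The node at the parameters of record `(θ, θ₀) = (1/25, 1/2000)`. [this file] -/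
theorem sitewiseRechartLoss_record_of_far_coherence_cost (hF : FarFieldShadowBound (1 / 25) (1 / 2000))
    (hS : ShortRangeCoherence (1 / 25) (1 / 2000)) (hI : IncoherenceCost (1 / 25) (1 / 2000)) :
    SitewiseRechartLoss (1 / 25) (1 / 2000) :=
  sitewiseRechartLoss_of_far_coherence_cost hF hS hI

/-- ★ **SLOT Z FROM THE LEAVES WITH Z3k SPLIT:
`FarCoreExcess ∧ ShelteredFarCharting ∧ NormalCorePricing ∧ TailDriftBound ∧ FarFieldShadowBound ∧ ShortRangeCoherence ∧ IncoherenceCost ∧ ScaleBadFloor ⇒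
FarAggregatePricing 12 (1/25) (1/2000) (1/(2·10⁷))`** — the landed record `farAggregatePricing_record_of_six_leaves_sitewise` with Z3k supplied by this node. [this file] -/
theorem farAggregatePricing_record_of_leaves_coherence
    (h2 : FarCoreExcess (1 / 25) (1 / 2000) (1 / (2 * 10 ^ 7)))
    (hra : ShelteredFarCharting (1 / 25) (1 / 2000)) (hrb : NormalCorePricing (1 / 25))
    (h3a : TailDriftBound (1 / 25) (1 / 2000)) (hF : FarFieldShadowBound (1 / 25) (1 / 2000))
    (hS : ShortRangeCoherence (1 / 25) (1 / 2000)) (hI : IncoherenceCost (1 / 25) (1 / 2000))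
    (h4 : ScaleBadFloor (1 / 25) (1 / (2 * 10 ^ 7))) :
    FarAggregatePricing 12 (1 / 25) (1 / 2000) (1 / (2 * 10 ^ 7)) :=
  farAggregatePricing_record_of_six_leaves_sitewise h2 hra hrb h3a (sitewiseRechartLoss_record_of_far_coherence_cost hF hS hI) h4

end Summit.AtomisticToContinuum.Crystallization.Theorems.OverbindingBudgetAffineFarSmoothSplit
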